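import Literature.Barriers.HodgeConjecture.IntegralCoefficients
import Literature.AlgebraicTopology.SingularHomology.FinitePunctureCohomology
import Literature.AlgebraicGeometry.Motives.ComplexPointsManifold
import Literature.AlgebraicGeometry.HodgeTheory.TopDegreeClasses
import Literature.AlgebraicGeometry.HodgeTheory.ClassesSupportedOn
import Literature.AlgebraicGeometry.Motives.VarietiesQuasiCompactProofs
import Mathlib.AlgebraicGeometry.Noetherian
import Mathlib.Topology.NoetherianSpace
import Mathlib.Topology.Sober
import HarnessLib

/-!
# Integral classes with supports: finitely many closed points do not matter below the top degree

Sibling of `Literature/Barriers/HodgeConjecture/IntegralCoefficients` (D-0021 catalogue), serving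
the barrier fact `Kollar1992_nonTorsionClass_notAlgebraic` (Kollár 1992 / Soulé–Voisin 2005, §2:
a non-torsion `α ∈ H⁴(X(ℂ); ℤ)` outside `N² H⁴(X(ℂ); ℤ) = integralAlgebraicClasses X 2`). That
file renders "integral combination of classes of algebraic cycles" by KERNELS OF RESTRICTIONS
`ker (Hᵏ(X(ℂ); ℤ) → Hᵏ((X ∖ Z)(ℂ); ℤ))`, `Z ⊆ X` Zariski-closed, so hypothesis (i) of
`IntegralCoefficientsKollarProofs` (integral PURITY plus Kollár's `p ∣ deg C`) must first decompose an
arbitrary closed `Z` of codimension `≥ 2` (finitely many curves and isolated closed points, meeting in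
finitely many closed points) into irreducible curves. This file proves the topological half of that
decomposition, with `ℤ`-coefficients, for `X` smooth projective of dimension `n` over `ℂ` (`X(ℂ)` is
a compact Hausdorff `2n`-manifold, `Motives/ComplexPointsManifold`):

* `ker_restrictComplInt_union_finite`: for `Z` closed and `S` finite,
  `ker (Hᵏ(X(ℂ);ℤ) → Hᵏ((X ∖ (Z ∪ S))(ℂ);ℤ)) = ker (Hᵏ(X(ℂ);ℤ) → Hᵏ((X ∖ Z)(ℂ);ℤ))` for
  `2 ≤ k ≠ 2n` — the complex points over `S` form a finite subset of the open `2n`-manifold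
  `(X ∖ Z)(ℂ)`, and removing finitely many points from a manifold does not change `Hᵏ(-; ℤ)` in
  degrees `2 ≤ k ≤ 2n - 2` (Hatcher 2002, §3.3 p. 231: the local cohomology of a point of a
  `d`-manifold is concentrated in degree `d`; the tree's `map_inclusion_injective_of_finite_diff`,
  `Literature/AlgebraicTopology/SingularHomology/FinitePunctureCohomology`);
* `ker_restrictComplInt_eq_bot_of_finite`, `integralSupportedClasses_eq_bot`:
  **`Nⁿ Hᵏ(X(ℂ); ℤ) = 0` for `2 ≤ k ≠ 2n`** — a Zariski-closed subset all of whose points have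
  codimension `≥ n = dim X` is a finite set of closed points (`height + coheight = n`, Hartshorne
  II Ex. 3.20 (d); generic points of the finitely many components, I Prop. 1.5, II Ex. 2.9), on which
  no non-zero class of degree `k ≠ 2n` is supported (`N³ H⁴ = 0` on threefolds);
* `ker_restrictComplInt_union_eq_sup`: **additivity of supports** — for `Z₁`, `Z₂` closed
  meeting in finitely many points, `ker_{Z₁ ∪ Z₂} = ker_{Z₁} + ker_{Z₂}` for `1 ≤ k`, `k + 1 ≠ 2n`
  (Mayer–Vietoris gluing over `(X ∖ Z₁)(ℂ) ∪ (X ∖ Z₂)(ℂ)`, Hatcher §3.1 pp. 203–204, and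
  surjectivity of `Hᵏ(X(ℂ)) → Hᵏ((X ∖ (Z₁ ∩ Z₂))(ℂ))`); the `ℤ`-coefficient support calculus behind
  "`H⁴_Z(X; ℤ)` is free on the classes of the curve components of `Z`" (Fulton §19.1 Lemma 19.1.1).

The decomposition of hypothesis (i) of the Kollár reduction over IRREDUCIBLE curves is assembled from
these in the sibling `IntegralCoefficientsKollarCurves`. Everything is proved; no named facts.

## References

* [HatcherAT2002] Hatcher, Algebraic Topology, §3.1 pp. 203–204, §3.3 p. 231; [GrothendieckTopology1969] §1.
* [Fulton1998] W. Fulton, Intersection Theory, §19.1, Lemma 19.1.1.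
* [Hartshorne1977] R. Hartshorne, Algebraic Geometry, I Prop. 1.5, II Ex. 2.9, II Ex. 3.20 (d).
* [SouleVoisin2005] Soulé–Voisin, Adv. Math. 198 (2005), §2 Thm. 2; [KollarTrento1992] Kollár, LNM 1515, §1.
-/

noncomputable section

open CategoryTheory AlgebraicGeometry Set Topology
open Literature.AlgebraicTopology.SingularHomology Literature.AlgebraicGeometry.Motives

namespace Literature.Barriers.HodgeConjecture

section Barriers
section HodgeConjecture

/-! ### Point-set preliminaries: closed points and finite closed subsets -/

section PointSet

/-- **A quasi-sober Noetherian space all of whose points are closed is finite**: every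
irreducible component has a generic point, which is closed, so the (finitely many, Hartshorne I
Prop. 1.5) irreducible components are points. [cite: Hartshorne1977, I Prop. 1.5 and II Ex. 2.9] -/
theorem finite_of_noetherianSpace_of_t1Space (α : Type*) [TopologicalSpace α] [QuasiSober α]
    [TopologicalSpace.NoetherianSpace α] [T1Space α] : Finite α := by
  have key : ∀ x : α, irreducibleComponent x = {x} := fun x ↦ by
    obtain ⟨η, hη⟩ := QuasiSober.sober (isIrreducible_irreducibleComponent (x := x))
      isClosed_irreducibleComponent
    have h1 : closure ({η} : Set α) = irreducibleComponent x := hη.def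
    rw [closure_singleton] at h1
    have hx : x ∈ ({η} : Set α) := h1 ▸ mem_irreducibleComponent
    rw [mem_singleton_iff] at hx
    subst hx
    exact h1.symm
  haveI : Finite ↥(irreducibleComponents α) :=
    (TopologicalSpace.NoetherianSpace.finite_irreducibleComponents (α := α)).to_subtype
  refine Finite.of_injective (fun x : α ↦ (⟨irreducibleComponent x,
    irreducibleComponent_mem_irreducibleComponents x⟩ : ↥(irreducibleComponents α))) ?_
  intro x y hxy
  have h := congrArg Subtype.val hxy
  simp only [key] at h
  exact singleton_injective h

/-- **A closed subset of a quasi-sober Noetherian space consisting of closed points is finite**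
(Hartshorne I Prop. 1.5: it is the union of its finitely many irreducible components, each the
closure of a generic point lying in it). [cite: Hartshorne1977, I Prop. 1.5 and II Ex. 2.9] -/
theorem finite_of_isClosed_of_forall_isClosed_singleton {α : Type*} [TopologicalSpace α]
    [QuasiSober α] [TopologicalSpace.NoetherianSpace α] {Z : Set α} (hZ : IsClosed Z)
    (h : ∀ z ∈ Z, IsClosed ({z} : Set α)) : Z.Finite := by
  haveI : QuasiSober ↥Z := hZ.isClosedEmbedding_subtypeVal.quasiSober
  haveI : T1Space ↥Z := ⟨fun z ↦ by
    have hc : IsClosed ((Subtype.val : ↥Z → α) ⁻¹' {z.1}) :=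
      (h z.1 z.2).preimage continuous_subtype_val
    have hs : ((Subtype.val : ↥Z → α) ⁻¹' {z.1}) = {z} := by
      ext w
      simp only [mem_preimage, mem_singleton_iff, Subtype.ext_iff]
    rwa [hs] at hc⟩
  exact Set.finite_coe_iff.mp (finite_of_noetherianSpace_of_t1Space ↥Z)

variable {n : ℕ} {X : SchemeOver ℂ}

/-- **Points of codimension `≥ n` on a smooth projective `n`-fold are closed points**:
`height z + coheight z = n` (Hartshorne II Ex. 3.20 (d); the tree's
`height_add_coheight_eq_of_smoothOfRelativeDimension`) forces `height z = 0`, so `z` has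
no proper specialisation and `{z}` is closed (schemes are `T₀`). [cite: Hartshorne1977, II Ex. 3.20 (d)] -/
theorem isClosed_singleton_of_le_coheight (hX : IsSmoothProjective n X) {z : X.left}
    (hz : (n : ℕ∞) ≤ Order.coheight z) : IsClosed ({z} : Set X.left) := by
  haveI := hX.smoothOfRelativeDimension
  haveI := hX.geometricallyIrreducible
  haveI : IrreducibleSpace ↥X.left := GeometricallyIrreducible.irreducibleSpace_of_subsingleton X.hom
  have hsum :=
    Literature.AlgebraicGeometry.Motives.height_add_coheight_eq_of_smoothOfRelativeDimension X.hom n z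
  have hh : Order.height z ≠ ⊤ := by
    intro h
    rw [h, top_add] at hsum
    exact ENat.top_ne_coe n hsum
  have hc : Order.coheight z ≠ ⊤ := by
    intro h
    rw [h, add_top] at hsum
    exact ENat.top_ne_coe n hsum
  obtain ⟨a, ha⟩ := ENat.ne_top_iff_exists.mp hh
  obtain ⟨b, hb⟩ := ENat.ne_top_iff_exists.mp hc
  rw [← ha, ← hb] at hsum
  rw [← hb] at hz
  have hab : a + b = n := by exact_mod_cast hsum
  have hnb : n ≤ b := by exact_mod_cast hz
  have ha0 : a = 0 := by omega
  subst ha0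
  have hmin : IsMin z := Order.height_eq_zero.mp (by rw [← ha]; rfl)
  refine closure_subset_iff_isClosed.mp fun y hy ↦ ?_
  have hzy : z ⤳ y := specializes_iff_mem_closure.mpr hy
  have hyz : y ⤳ z := Scheme.le_iff_specializes.mp (hmin (Scheme.le_iff_specializes.mpr hzy))
  exact mem_singleton_iff.mpr (hyz.antisymm hzy).eq

/-- **A closed subset of codimension `≥ n` on a smooth projective `n`-fold is a finite set of closed
points** (`X` is Noetherian; Hartshorne I Prop. 1.5, II Ex. 3.20 (d)). [cite: Hartshorne1977, I Prop. 1.5 and II Ex. 3.20 (d)] -/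
theorem finite_of_isClosed_of_le_coheight (hX : IsSmoothProjective n X) {Z : Set X.left}
    (hZ : IsClosed Z) (hZn : ∀ z ∈ Z, (n : ℕ∞) ≤ Order.coheight z) : Z.Finite := by
  haveI : IsLocallyNoetherian X.left := IsSmoothProjective.isLocallyNoetherian_holds hX
  haveI : CompactSpace X.left := IsSmoothProjective.compactSpace_holds hX
  haveI : IsNoetherian X.left := {}
  exact finite_of_isClosed_of_forall_isClosed_singleton hZ
    fun z hz ↦ isClosed_singleton_of_le_coheight hX (hZn z hz)

/-- **On an irreducible closed subset of dimension `≤ 1`, every point other than the generic point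
is a closed point**: for `C ⊆ X` closed irreducible all of whose points have codimension `≥ r`,
`dim X = r + 1`, a point `z ∈ C` different from the generic point `η` of `C` is a proper
specialisation of `η`, so `coheight z ≥ coheight η + 1 ≥ r + 1` (Hartshorne II Ex. 3.20 (d),
Ex. 2.9). [cite: Hartshorne1977, II Ex. 2.9 and II Ex. 3.20 (d)] -/
theorem isClosed_singleton_of_ne_genericPoint {r : ℕ} (hX : IsSmoothProjective (r + 1) X)
    {C : Set X.left} (hC : IsIrreducible C) (hCc : IsClosed C)
    (hCr : ∀ z ∈ C, (r : ℕ∞) ≤ Order.coheight z) {z : X.left} (hz : z ∈ C)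
    (hne : z ≠ hC.genericPoint) : IsClosed ({z} : Set X.left) := by
  have hη : IsGenericPoint hC.genericPoint C := hC.isGenericPoint_genericPoint hCc
  have hηz : hC.genericPoint ⤳ z := hη.specializes hz
  have hlt : z < hC.genericPoint := by
    refine lt_of_le_not_ge (Scheme.le_iff_specializes.mpr hηz) fun hle ↦ hne ?_
    exact ((Scheme.le_iff_specializes.mp hle).antisymm hηz).eq
  refine isClosed_singleton_of_le_coheight hX ?_
  calc ((r + 1 : ℕ) : ℕ∞) = (r : ℕ∞) + 1 := by push_cast; rfl
    _ ≤ Order.coheight hC.genericPoint + 1 := add_le_add (hCr _ hη.mem) le_rfl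
    _ ≤ Order.coheight z := Order.coheight_add_one_le hlt

/-- **Proper closed subsets of an irreducible curve are finite**: with `C` as above, a closed
`D ⊆ C` missing the generic point of `C` consists of closed points, hence is finite
(Hartshorne I Prop. 1.5, II Ex. 3.20 (d)). [cite: Hartshorne1977, I Prop. 1.5 and II Ex. 3.20 (d)] -/
theorem finite_of_isClosed_of_genericPoint_notMem {r : ℕ} (hX : IsSmoothProjective (r + 1) X)
    {C : Set X.left} (hC : IsIrreducible C) (hCc : IsClosed C)
    (hCr : ∀ z ∈ C, (r : ℕ∞) ≤ Order.coheight z) {D : Set X.left} (hD : IsClosed D) (hDC : D ⊆ C)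
    (hη : hC.genericPoint ∉ D) : D.Finite := by
  haveI : IsLocallyNoetherian X.left := IsSmoothProjective.isLocallyNoetherian_holds hX
  haveI : CompactSpace X.left := IsSmoothProjective.compactSpace_holds hX
  haveI : IsNoetherian X.left := {}
  exact finite_of_isClosed_of_forall_isClosed_singleton hD fun z hz ↦
    isClosed_singleton_of_ne_genericPoint hX hC hCc hCr (hDC hz) fun h ↦ hη (h ▸ hz)

/-- The complex points over a Zariski-closed `Z ⊆ X` form a closed subset of `X(ℂ)` (the analytic
topology refines the Zariski topology; the tree's `AlgPoints.isOpen_setOf_pt_mem`, Serre GAGA §2).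
[cite: SerreGAGA1956, §2] -/
theorem isClosed_setOf_pt_mem_int {Z : Set X.left} (hZ : IsClosed Z) :
    IsClosed {P : ComplexPoints X | P.pt ∈ Z} :=
  ⟨AlgPoints.isOpen_setOf_pt_mem (X := X) (L := ℂ) ⟨Zᶜ, hZ.isOpen_compl⟩⟩

/-- Over a finite set of scheme points lie only finitely many complex points (complex points
correspond injectively to closed points, `ComplexPoints.equivClosedPoints`; Nullstellensatz).
[cite: MumfordRedBook1999, I.10] -/
theorem finite_setOf_pt_mem [LocallyOfFiniteType X.hom] {S : Set X.left} (hS : S.Finite) :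
    {P : ComplexPoints X | P.pt ∈ S}.Finite :=
  hS.preimage fun _ _ _ _ hPQ ↦ (ComplexPoints.equivClosedPoints X).injective (Subtype.ext hPQ)

end PointSet

/-! ### Kernels of restrictions: functoriality -/

section Kernels

variable {n : ℕ} {X : SchemeOver ℂ}

/-- Restriction to `(X ∖ Z')(ℂ)` factors through restriction to `(X ∖ Z)(ℂ)` for `Z ⊆ Z'`
(contravariant functoriality of `Hᵏ`; the `ℤ`-coefficient copy of the tree's
`HodgeTheory.restrictCompl_eq_comp`). [cite: GrothendieckTopology1969, §1] -/
theorem restrictComplInt_eq_comp {Z Z' : Set X.left} (h : Z ⊆ Z') (k : ℕ) :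
    restrictComplInt X Z' k = restrictComplInt X Z k ≫
      singularCohomology.map ℤ ℤ (Literature.AlgebraicGeometry.HodgeTheory.complexPointsComplInclusion h) k := by
  rw [restrictComplInt, restrictComplInt, ← singularCohomology.map_comp]
  rfl

/-- **Monotonicity in the support** (`ℤ`-coefficients): `Z ⊆ Z' ⇒ ker_Z ≤ ker_{Z'}`.
[cite: GrothendieckTopology1969, §1] -/
theorem ker_restrictComplInt_mono {Z Z' : Set X.left} (h : Z ⊆ Z') (k : ℕ) :
    LinearMap.ker (restrictComplInt X Z k).hom ≤ LinearMap.ker (restrictComplInt X Z' k).hom := by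
  intro x hx
  have hx' : restrictComplInt X Z k x = 0 := hx
  show restrictComplInt X Z' k x = 0
  rw [restrictComplInt_eq_comp h k, ModuleCat.comp_apply, hx', map_zero]

/-- **No non-zero class is supported on `∅`** (`ℤ`-coefficients): restriction to
`(X ∖ ∅)(ℂ) = X(ℂ)` is an isomorphism. [cite: GrothendieckTopology1969, §1] -/
theorem ker_restrictComplInt_empty (k : ℕ) :
    LinearMap.ker (restrictComplInt X (∅ : Set X.left) k).hom = ⊥ := by
  refine eq_bot_iff.2 fun x hx ↦ ?_
  have hx' : restrictComplInt X ∅ k x = 0 := hx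
  have hiso : restrictComplInt X ∅ k =
      (singularCohomology.mapIso ℤ ℤ (Literature.AlgebraicGeometry.HodgeTheory.complexPointsComplEmptyHomeomorph X) k).hom := rfl
  rw [hiso] at hx'
  have h := CategoryTheory.Iso.hom_inv_id_apply
    (singularCohomology.mapIso ℤ ℤ (Literature.AlgebraicGeometry.HodgeTheory.complexPointsComplEmptyHomeomorph X) k) x
  rw [hx', map_zero] at h
  exact (Submodule.mem_bot ℤ).2 h.symm

/-! ### Finitely many closed points do not change kernels of restrictions -/

/-- **`ker (Hᵏ(X(ℂ);ℤ) → Hᵏ((X ∖ (Z ∪ S))(ℂ);ℤ)) = ker (Hᵏ(X(ℂ);ℤ) → Hᵏ((X ∖ Z)(ℂ);ℤ))` for `S`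
finite, `2 ≤ k ≠ 2 dim X`.** The complex points over `S` outside `Z` form a finite subset of the
open subset `(X ∖ Z)(ℂ)` of the `2n`-manifold `X(ℂ)`, and `Hᵏ((X ∖ Z)(ℂ); ℤ) → Hᵏ((X ∖ (Z ∪ S))(ℂ); ℤ)`
is injective (removing finitely many points; Hatcher 2002, §3.3 p. 231 with §3.1 pp. 203–204, the
tree's `map_inclusion_injective_of_finite_diff`). [cite: HatcherAT2002, §3.3 p. 231 and §3.1 pp. 203–204]
[cite: GrothendieckTopology1969, §1] -/
theorem ker_restrictComplInt_union_finite (hX : IsSmoothProjective n X) (hn : 1 ≤ n)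
    {Z : Set X.left} (hZ : IsClosed Z) {S : Set X.left} (hS : S.Finite) {k : ℕ} (hk : 2 ≤ k)
    (hkn : k ≠ 2 * n) :
    LinearMap.ker (restrictComplInt X (Z ∪ S) k).hom = LinearMap.ker (restrictComplInt X Z k).hom := by
  haveI := hX.smoothOfRelativeDimension
  haveI : Smooth X.hom := SmoothOfRelativeDimension.smooth n X.hom
  letI := hX.chartedSpace
  haveI := ComplexPoints.t2Space_of_isSmoothProjective hX
  refine le_antisymm ?_ (ker_restrictComplInt_mono subset_union_left k)
  -- the open set `W = (X ∖ Z)(ℂ)` and its subset `V = (X ∖ (Z ∪ S))(ℂ)` with finite difference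
  let W : Set (ComplexPoints X) := {P | P.pt ∉ Z}
  let V : Set (ComplexPoints X) := {P | P.pt ∉ Z ∪ S}
  have hWo : IsOpen W := (isClosed_setOf_pt_mem_int hZ).isOpen_compl
  have hVW : V ⊆ W := fun P hP hPZ ↦ hP (Or.inl hPZ)
  have hfin : (W \ V).Finite := by
    refine (finite_setOf_pt_mem (X := X) hS).subset fun P hP ↦ ?_
    by_contra hPS
    exact hP.2 fun h ↦ h.elim hP.1 hPS
  have hinj := map_inclusion_injective_of_finite_diff (d := 2 * n) (by omega) hWo hVW hfin hk hkn
  -- the same map, with the types of `restrictComplInt`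
  have hinj' : Function.Injective (singularCohomology.map ℤ ℤ
      (Literature.AlgebraicGeometry.HodgeTheory.complexPointsComplInclusion
        (subset_union_left : Z ⊆ Z ∪ S)) k) := hinj
  intro x hx
  have hx' : restrictComplInt X (Z ∪ S) k x = 0 := hx
  show restrictComplInt X Z k x = 0
  rw [restrictComplInt_eq_comp (subset_union_left : Z ⊆ Z ∪ S) k, ModuleCat.comp_apply] at hx'
  exact hinj' (hx'.trans (map_zero _).symm)

/-- **No non-zero class of degree `2 ≤ k ≠ 2 dim X` is supported on a finite set of points**:
`ker (Hᵏ(X(ℂ);ℤ) → Hᵏ((X ∖ S)(ℂ);ℤ)) = 0` for `S` finite. [cite: HatcherAT2002, §3.3 p. 231]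
[cite: GrothendieckTopology1969, §1] -/
theorem ker_restrictComplInt_eq_bot_of_finite (hX : IsSmoothProjective n X) (hn : 1 ≤ n)
    {S : Set X.left} (hS : S.Finite) {k : ℕ} (hk : 2 ≤ k) (hkn : k ≠ 2 * n) :
    LinearMap.ker (restrictComplInt X S k).hom = ⊥ := by
  have h := ker_restrictComplInt_union_finite hX hn isClosed_empty hS hk hkn
  rw [Set.empty_union, ker_restrictComplInt_empty] at h
  exact h

variable (X) in
/-- **`Nⁿ Hᵏ(X(ℂ); ℤ) = 0` for `2 ≤ k ≠ 2n`, `n = dim X ≥ 1`**: a Zariski-closed subset all of whose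
points have codimension `≥ n` is a finite set of closed points (`finite_of_isClosed_of_le_coheight`),
on which no non-zero class of degree `k ≠ 2n` is supported (`ker_restrictComplInt_eq_bot_of_finite`).
In particular `N³ H⁴(X(ℂ); ℤ) = 0` on a smooth projective threefold: with
`integralSupportedClasses_zero` (`N⁰ = H⁴`) this brackets the two barrier facts, whose failures of
algebraicity live in `N² H⁴`. [cite: GrothendieckTopology1969, §1] [cite: HatcherAT2002, §3.3 p. 231] -/
theorem integralSupportedClasses_eq_bot (hX : IsSmoothProjective n X) (hn : 1 ≤ n) {k : ℕ}
    (hk : 2 ≤ k) (hkn : k ≠ 2 * n) : integralSupportedClasses X k n = ⊥ := by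
  refine eq_bot_iff.2 (iSup_le fun Z ↦ iSup_le fun hZ ↦ iSup_le fun hZn ↦ ?_)
  rw [ker_restrictComplInt_eq_bot_of_finite hX hn (finite_of_isClosed_of_le_coheight hX hZ hZn) hk hkn]

/-! ### Additivity of supports over closed sets meeting in finitely many points -/

/-- **`ker_{Z₁ ∪ Z₂} = ker_{Z₁} + ker_{Z₂}` for closed `Z₁, Z₂ ⊆ X` meeting in finitely many points**,
in degrees `1 ≤ k` with `k + 1 ≠ 2 dim X`. Given `x` dying on `(X ∖ (Z₁ ∪ Z₂))(ℂ) =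
(X ∖ Z₁)(ℂ) ∩ (X ∖ Z₂)(ℂ)`, glue `x|_{(X ∖ Z₁)(ℂ)}` and `0` to a class on the union
`(X ∖ (Z₁ ∩ Z₂))(ℂ)` (Mayer–Vietoris, Hatcher 2002, §3.1 pp. 203–204; the tree's
`singularCohomology.exists_of_map_inclusion_eq_union`), and lift it to `X(ℂ)`
(`Hᵏ(X(ℂ)) → Hᵏ(X(ℂ) ∖ finite)` is onto, `map_inclusion_surjective_of_finite_diff`,
Hatcher §3.3 p. 231): the lift `y` dies off `Z₂` and `x - y` dies off `Z₁`. This is the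
`ℤ`-coefficient support calculus behind "`H⁴_Z(X; ℤ)` is generated by the classes of the curve
components of `Z`" (Fulton 1998, §19.1 Lemma 19.1.1). [cite: HatcherAT2002, §3.1 pp. 203–204 and §3.3 p. 231]
[cite: Fulton1998, §19.1 Lemma 19.1.1] -/
theorem ker_restrictComplInt_union_eq_sup (hX : IsSmoothProjective n X) (hn : 1 ≤ n)
    {Z₁ Z₂ : Set X.left} (hZ₁ : IsClosed Z₁) (hZ₂ : IsClosed Z₂) (hfin : (Z₁ ∩ Z₂).Finite)
    {k : ℕ} (hk : 1 ≤ k) (hkn' : k + 1 ≠ 2 * n) :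
    LinearMap.ker (restrictComplInt X (Z₁ ∪ Z₂) k).hom =
      LinearMap.ker (restrictComplInt X Z₁ k).hom ⊔ LinearMap.ker (restrictComplInt X Z₂ k).hom := by
  haveI := hX.smoothOfRelativeDimension
  haveI : Smooth X.hom := SmoothOfRelativeDimension.smooth n X.hom
  letI := hX.chartedSpace
  haveI := ComplexPoints.t2Space_of_isSmoothProjective hX
  refine le_antisymm ?_ (sup_le (ker_restrictComplInt_mono subset_union_left k)
    (ker_restrictComplInt_mono subset_union_right k))
  intro x hx
  have hx' : restrictComplInt X (Z₁ ∪ Z₂) k x = 0 := hx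
  -- the two open pieces `A = (X ∖ Z₁)(ℂ)`, `B = (X ∖ Z₂)(ℂ)` of `X(ℂ)`
  let A : Set (ComplexPoints X) := {P | P.pt ∉ Z₁}
  let B : Set (ComplexPoints X) := {P | P.pt ∉ Z₂}
  have hA : IsOpen A := (isClosed_setOf_pt_mem_int hZ₁).isOpen_compl
  have hB : IsOpen B := (isClosed_setOf_pt_mem_int hZ₂).isOpen_compl
  -- `A ∩ B` versus `(X ∖ (Z₁ ∪ Z₂))(ℂ)`
  let AB : Set (ComplexPoints X) := {P | P.pt ∉ Z₁ ∪ Z₂}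
  have hxAB : singularCohomology.map ℤ ℤ (subsetIncl AB) k x = 0 := hx
  have hAB : A ∩ B = AB := by
    ext P
    simp only [A, B, AB, mem_inter_iff, mem_setOf_eq, mem_union, not_or]
  let e : ↥(A ∩ B) ≃ₜ ↥AB := Homeomorph.setCongr hAB
  have hm1 : singularCohomology.map ℤ ℤ (subsetIncl A) k ≫ singularCohomology.map ℤ ℤ
      (ContinuousMap.inclusion (inter_subset_left : A ∩ B ⊆ A)) k =
        singularCohomology.map ℤ ℤ (subsetIncl (A ∩ B)) k := by
    rw [← singularCohomology.map_comp]; rfl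
  have hm2 : singularCohomology.map ℤ ℤ (subsetIncl AB) k ≫
      singularCohomology.map ℤ ℤ (e : C(↥(A ∩ B), ↥AB)) k =
        singularCohomology.map ℤ ℤ (subsetIncl (A ∩ B)) k := by
    rw [← singularCohomology.map_comp]; rfl
  -- the class `a = x|_A` and `0` on `B` agree on `A ∩ B`
  set a : singularCohomology ℤ ℤ (↥A) k := singularCohomology.map ℤ ℤ (subsetIncl A) k x with ha
  have hab : singularCohomology.map ℤ ℤ
      (ContinuousMap.inclusion (inter_subset_left : A ∩ B ⊆ A)) k a =
        singularCohomology.map ℤ ℤ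
          (ContinuousMap.inclusion (inter_subset_right : A ∩ B ⊆ B)) k 0 := by
    rw [map_zero, ha, ← ModuleCat.comp_apply, hm1, ← hm2, ModuleCat.comp_apply, hxAB, map_zero]
  obtain ⟨c, hcA, hcB⟩ := singularCohomology.exists_of_map_inclusion_eq_union ℤ hA hB a 0 hab
  -- lift `c` to `X(ℂ)`: the complement of `A ∪ B` (complex points over `Z₁ ∩ Z₂`) is finite
  have hfin' : ((univ : Set (ComplexPoints X)) \ (A ∪ B)).Finite := by
    refine (finite_setOf_pt_mem (X := X) hfin).subset fun P hP ↦ ?_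
    have hP' : P ∉ A ∪ B := hP.2
    simp only [A, B, mem_union, mem_setOf_eq, not_or, not_not] at hP'
    exact hP'
  have hsurj : Function.Surjective (singularCohomology.map ℤ ℤ (subsetIncl (A ∪ B)) k) := by
    have h1 := map_inclusion_surjective_of_finite_diff (d := 2 * n) (by omega) isOpen_univ
      (subset_univ (A ∪ B)) hfin' hk hkn'
    have h2 : Function.Surjective (singularCohomology.map ℤ ℤ
        ((Homeomorph.Set.univ (ComplexPoints X) : C(↥(univ : Set (ComplexPoints X)),
          ComplexPoints X))) k) :=
      ((forget (ModuleCat ℤ)).mapIso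
        (singularCohomology.mapIso ℤ ℤ (Homeomorph.Set.univ (ComplexPoints X)) k)).toEquiv.surjective
    have hcomp : (subsetIncl (A ∪ B) : C(↥(A ∪ B), ComplexPoints X)) =
        ((Homeomorph.Set.univ (ComplexPoints X) : C(_, _))).comp
          (ContinuousMap.inclusion (subset_univ (A ∪ B))) := by
      ext; rfl
    rw [hcomp, singularCohomology.map_comp]
    exact h1.comp h2
  obtain ⟨y, hy⟩ := hsurj c
  have hm3 : singularCohomology.map ℤ ℤ (subsetIncl (A ∪ B)) k ≫ singularCohomology.map ℤ ℤ
      (ContinuousMap.inclusion (subset_union_right : B ⊆ A ∪ B)) k =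
        singularCohomology.map ℤ ℤ (subsetIncl B) k := by
    rw [← singularCohomology.map_comp]; rfl
  have hm4 : singularCohomology.map ℤ ℤ (subsetIncl (A ∪ B)) k ≫ singularCohomology.map ℤ ℤ
      (ContinuousMap.inclusion (subset_union_left : A ⊆ A ∪ B)) k =
        singularCohomology.map ℤ ℤ (subsetIncl A) k := by
    rw [← singularCohomology.map_comp]; rfl
  -- `y` dies off `Z₂`
  have hy2 : singularCohomology.map ℤ ℤ (subsetIncl B) k y = 0 := by
    rw [← hm3, ModuleCat.comp_apply, hy, hcB]
  -- `x - y` dies off `Z₁`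
  have hy1 : singularCohomology.map ℤ ℤ (subsetIncl A) k (x - y) = 0 := by
    have h : singularCohomology.map ℤ ℤ (subsetIncl A) k y = a := by
      rw [← hm4, ModuleCat.comp_apply, hy, hcA]
    rw [map_sub, h, ha]
    exact sub_self _
  have hy1' : x - y ∈ LinearMap.ker (restrictComplInt X Z₁ k).hom := hy1
  have hy2' : y ∈ LinearMap.ker (restrictComplInt X Z₂ k).hom := hy2
  exact Submodule.mem_sup.mpr ⟨x - y, hy1', y, hy2', sub_add_cancel x y⟩

end Kernels

end HodgeConjecture
end Barriers

end Literature.Barriers.HodgeConjecture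

end
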